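import Literature.Geometry.Symplectic.PencilEndMemberSphere
import Literature.Geometry.Symplectic.JPlanePencilMemberSphere
import Literature.Geometry.Symplectic.TwoChartSphereEnergyChart
import Literature.Topology.FourManifolds.ComplexProjectiveLineClutching
import HarnessLib

/-!
# The compactified pencil member as a smooth embedded Riemann sphere (glued maps)

Topic `Literature/Geometry/Symplectic` (infrastructure for
`Literature.Geometry.Symplectic.jPlanePencil_localFamily_homotopySphere`, Wendl LNM 2216, proof of
Prop. 2.53, p. 65).

A two-chart sphere `(u, v)` in a `4`-manifold `X` (`u v : ℂ → X` smooth, `v z = u z⁻¹` off `0`)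
glues to a map `twoChartGlue u v : ℂℙ¹ → X` (`JPlanePencilMemberSphere.lean`). Here we record,
for the manifold structure of `ℂℙ¹` (model `ℝ²`, the two affine charts), that the glued map is

* `C^∞` when both charts are (`contMDiff_twoChartGlue`),
* injective when `u` is and `v 0 ∉ range u` (`injective_twoChartGlue`),
* an immersion when both charts are (`injective_mfderiv_twoChartGlue`),

and apply this to the two compactifications of a member `u` of Gromov's pencil of `J`-planes:
the capped sphere `capGlue u = u(ℂ) ∪ {p}` in `M` (charts `val ∘ u`, `pencilCap p u`) and the
compactified member `G.memberGlue u b` in the blown-up end `Y` (charts `G.memberU u`,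
`G.memberV u b` of `PencilEndMemberSphere.lean`): both are `C^∞` injective immersions
`ℂℙ¹ → M`, resp. `ℂℙ¹ → Y` — the input format of the framed-tube theorems of
`Literature/Topology/FourManifolds` (Kirby VIII.2 in homotopy `4`-spheres,
`exists_framedTube_of_homotopyEquiv_sphere_four`; tubes from framings,
`exists_isSmoothEmbedding_tube_of_isSmoothAlong`).

## References

* C. Wendl, *Holomorphic Curves in Low Dimensions*, LNM 2216 (2018), proof of Prop. 2.53, p. 65.
  [Wendl2018]
* P. Griffiths, J. Harris, *Principles of Algebraic Geometry* (1978), Ch. 0 §2 (the two affine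
  charts of `ℂℙ¹`). [GriffithsHarrisPrinciples1978]
-/

noncomputable section

open scoped Manifold ContDiff Topology
open Set Function Metric Filter Literature.Topology.FourManifolds
  Literature.Topology.FourManifolds.ComplexProjectiveSpace

namespace Literature.Geometry.Symplectic

/-! ### Smoothness, injectivity and immersion of glued two-chart spheres -/

section GlueAlgebra

variable {X : Type} {u v : ℂ → X}

/-- The charts of a two-chart sphere as a `Fin 2`-indexed family. [folklore] -/
def chartPair (u v : ℂ → X) : Fin 2 → ℂ → X := ![u, v]

/-- `chartPair u v 0 = u`. [folklore] -/
@[simp] theorem chartPair_zero (u v : ℂ → X) : chartPair u v 0 = u := rfl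

/-- `chartPair u v 1 = v`. [folklore] -/
@[simp] theorem chartPair_one (u v : ℂ → X) : chartPair u v 1 = v := rfl

/-- The glued map is, on each affine chart domain, the corresponding chart in the affine
coordinate. [folklore] -/
theorem twoChartGlue_eq_chartPair (huv : ∀ z : ℂ, z ≠ 0 → v z = u z⁻¹) (i : Fin 2)
    (q : ComplexProjectiveSpace 1) (hq : CoordNeZero i q) :
    twoChartGlue u v q = chartPair u v i (affineCoordComplex i q 0) := by
  fin_cases i
  · exact twoChartGlue_of_coordNeZero_zero hq
  · exact twoChartGlue_of_coordNeZero_one huv hq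

/-- **The glued map is injective** when `u` is injective and `v 0 ∉ range u`.
[folklore] -/
theorem injective_twoChartGlue (hinj : Injective u) (hnot : v 0 ∉ range u) :
    Injective (twoChartGlue u v) := by
  intro q q' hqq'
  by_cases h0 : CoordNeZero 0 q <;> by_cases h0' : CoordNeZero 0 q'
  · rw [twoChartGlue_of_coordNeZero_zero h0, twoChartGlue_of_coordNeZero_zero h0'] at hqq'
    have h := hinj hqq'
    rw [← affineChart_symm_affineCoordComplex h0, ← affineChart_symm_affineCoordComplex h0', h]
  · exfalso
    rw [twoChartGlue_of_coordNeZero_zero h0, twoChartGlue_of_not_coordNeZero_zero h0',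
      affineCoordComplex_one_eq_zero h0'] at hqq'
    exact hnot ⟨_, hqq'⟩
  · exfalso
    rw [twoChartGlue_of_not_coordNeZero_zero h0, twoChartGlue_of_coordNeZero_zero h0',
      affineCoordComplex_one_eq_zero h0] at hqq'
    exact hnot ⟨_, hqq'.symm⟩
  · rw [eq_affineChart_one_symm_of_not_coordNeZero h0, eq_affineChart_one_symm_of_not_coordNeZero h0']

/-- The linear map `Λ : ℝ² → ℂ` reading the affine coordinate in the model is injective.
[folklore] -/
theorem injective_lam :
    Injective ((ContinuousLinearMap.proj (0 : Fin 1) : (Fin 1 → ℂ) →L[ℝ] ℂ).comp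
      (realCoordinates 1).symm.toContinuousLinearMap) := by
  intro y y' h
  rw [← realCoordinates_proj_symm y, ← realCoordinates_proj_symm y']
  exact congrArg (fun z : ℂ => realCoordinates 1 (fun _ : Fin 1 => z)) h

end GlueAlgebra

section Glue

variable {X : Type} [TopologicalSpace X] [ChartedSpace (EuclideanSpace ℝ (Fin 4)) X] {u v : ℂ → X}

/-- Each chart of a smooth two-chart sphere is smooth. [folklore] -/
theorem contMDiff_chartPair (hu : ContMDiff 𝓘(ℝ, ℂ) (𝓡 4) ∞ u) (hv : ContMDiff 𝓘(ℝ, ℂ) (𝓡 4) ∞ v)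
    (i : Fin 2) : ContMDiff 𝓘(ℝ, ℂ) (𝓡 4) ∞ (chartPair u v i) := by
  fin_cases i
  · simpa [chartPair] using hu
  · simpa [chartPair] using hv

/-- Each chart of an immersed two-chart sphere is immersed. [folklore] -/
theorem injective_mfderiv_chartPair (himmu : ∀ z, Injective (mfderiv 𝓘(ℝ, ℂ) (𝓡 4) u z))
    (himmv : ∀ w, Injective (mfderiv 𝓘(ℝ, ℂ) (𝓡 4) v w)) (i : Fin 2) (z : ℂ) :
    Injective (mfderiv 𝓘(ℝ, ℂ) (𝓡 4) (chartPair u v i) z) := by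
  fin_cases i
  · exact himmu z
  · exact himmv z

/-- **The glued map of a smooth two-chart sphere is `C^∞` on `ℂℙ¹`.**
[cite: GriffithsHarrisPrinciples1978, Ch. 0 §2] -/
theorem contMDiff_twoChartGlue (hu : ContMDiff 𝓘(ℝ, ℂ) (𝓡 4) ∞ u)
    (hv : ContMDiff 𝓘(ℝ, ℂ) (𝓡 4) ∞ v) (huv : ∀ z : ℂ, z ≠ 0 → v z = u z⁻¹) :
    ContMDiff (𝓡 2) (𝓡 4) ∞ (twoChartGlue u v) := by
  have h : ContMDiff (𝓡 (2 * 1)) (𝓡 4) ∞ (twoChartGlue u v) := by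
    intro q
    obtain ⟨i, hi⟩ := exists_coordNeZero q
    have hc := ((contMDiff_chartPair hu hv i).comp_contMDiffOn
      (contMDiffOn_affineCoordComplex i)).contMDiffAt ((isOpen_setOf_coordNeZero i).mem_nhds hi)
    refine hc.congr_of_eventuallyEq ?_
    filter_upwards [(isOpen_setOf_coordNeZero i).mem_nhds hi] with q' hq'
    exact twoChartGlue_eq_chartPair huv i q' hq'
  exact h

/-- **The glued map is an immersion** when both charts are.
[cite: GriffithsHarrisPrinciples1978, Ch. 0 §2] -/
theorem injective_mfderiv_twoChartGlue
    (hu : ContMDiff 𝓘(ℝ, ℂ) (𝓡 4) ∞ u) (hv : ContMDiff 𝓘(ℝ, ℂ) (𝓡 4) ∞ v)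
    (huv : ∀ z : ℂ, z ≠ 0 → v z = u z⁻¹)
    (himmu : ∀ z, Injective (mfderiv 𝓘(ℝ, ℂ) (𝓡 4) u z))
    (himmv : ∀ w, Injective (mfderiv 𝓘(ℝ, ℂ) (𝓡 4) v w)) (y : ComplexProjectiveSpace 1) :
    Injective (mfderiv (𝓡 2) (𝓡 4) (twoChartGlue u v) y) := by
  have h : Injective (mfderiv (𝓡 (2 * 1)) (𝓡 4) (twoChartGlue u v) y) := by
    have hd := hasMFDerivAt_glued (w := chartPair u v (chartIndex y)) y
      (fun q hq => twoChartGlue_eq_chartPair huv (chartIndex y) q hq)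
      ((contMDiff_chartPair hu hv (chartIndex y) _).mdifferentiableAt (by simp))
    rw [hd.mfderiv]
    exact (injective_mfderiv_chartPair himmu himmv (chartIndex y) _).comp injective_lam
  exact h

end Glue

/-! ### The capped sphere of a pencil member in `M` -/

section Cap

variable {M : Type} [TopologicalSpace M] [T2Space M] {p : M} {u : ℂ → punctured p} {b : ℂ}

/-- **The capped sphere** `û = u(ℂ) ∪ {p} : ℂℙ¹ → M` of a plane `u : ℂ → M ∖ {p}`: the glued map
of the charts `val ∘ u` and `pencilCap p u`. [cite: Wendl2018, proof of Prop. 2.53 (p. 65)] -/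
def capGlue (u : ℂ → punctured p) : ComplexProjectiveSpace 1 → M :=
  twoChartGlue (fun ξ => (u ξ).1) (pencilCap p u)

/-- The two charts of the capped sphere are compatible. [folklore] -/
theorem pencilCap_compat (u : ℂ → punctured p) (z : ℂ) (hz : z ≠ 0) :
    pencilCap p u z = (fun ξ => (u ξ).1) z⁻¹ :=
  pencilCap_of_ne_zero hz

/-- The base point is not on the plane. [folklore] -/
theorem pencilCap_zero_notMem_range (u : ℂ → punctured p) :
    pencilCap p u 0 ∉ range (fun ξ => (u ξ).1) := by
  rintro ⟨ξ, hξ⟩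
  rw [pencilCap_zero] at hξ
  exact (mem_punctured.1 (u ξ).2) hξ

/-- `val ∘ u` is `C^∞` for a smooth plane. [folklore] -/
theorem contMDiff_val_comp [ChartedSpace (EuclideanSpace ℝ (Fin 4)) M] [IsManifold (𝓡 4) ∞ M] (hu : ContMDiff 𝓘(ℝ, ℂ) (𝓡 4) ∞ u) :
    ContMDiff 𝓘(ℝ, ℂ) (𝓡 4) ∞ (fun ξ => (u ξ).1) :=
  contMDiff_subtype_val.comp hu

/-- `d(val ∘ u) = du`. [folklore] -/
theorem hasMFDerivAt_val_comp [ChartedSpace (EuclideanSpace ℝ (Fin 4)) M] [IsManifold (𝓡 4) ∞ M] {ξ : ℂ} (hu : MDifferentiableAt 𝓘(ℝ, ℂ) (𝓡 4) u ξ) :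
    HasMFDerivAt 𝓘(ℝ, ℂ) (𝓡 4) (fun ξ => (u ξ).1) ξ (mfderiv 𝓘(ℝ, ℂ) (𝓡 4) u ξ) :=
  ((Literature.Geometry.Manifold.OpenSubmanifold.hasMFDerivAt_subtype_val (u ξ)).comp ξ
    hu.hasMFDerivAt).congr_mfderiv (ContinuousLinearMap.ext fun _ => rfl)

/-- **The capped sphere of a member is a `C^∞` injective immersion `ℂℙ¹ → M`.**
[cite: Wendl2018, proof of Prop. 2.53 (p. 65)] -/
theorem IsPencilPlane.capGlue_smooth_injective_immersion [ChartedSpace (EuclideanSpace ℝ (Fin 4)) M]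
    [CompactSpace M] [IsManifold (𝓡 4) ∞ M]
    {J : ∀ x : punctured p, TangentSpace (𝓡 4) x →L[ℝ] TangentSpace (𝓡 4) x} {ε : ℝ}
    (hu : IsPencilPlane J u b) (hε : 0 < ε)
    (hJstd : ∀ x : punctured p, InPuncturedChartBall p ε x →
      ∀ (v : TangentSpace (𝓡 4) x) (c : EuclideanSpace ℝ (Fin 4)),
        inner ℝ (fderiv ℝ inversion (extChartAt (𝓡 4) p x.1 - extChartAt (𝓡 4) p p)
          (mfderiv (𝓡 4) 𝓘(ℝ, EuclideanSpace ℝ (Fin 4))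
            (fun z : punctured p => extChartAt (𝓡 4) p z.1) x (J x v))) c
        = stdSymplecticForm (fderiv ℝ inversion (extChartAt (𝓡 4) p x.1 - extChartAt (𝓡 4) p p)
          (mfderiv (𝓡 4) 𝓘(ℝ, EuclideanSpace ℝ (Fin 4))
            (fun z : punctured p => extChartAt (𝓡 4) p z.1) x v)) c) :
    ContMDiff (𝓡 2) (𝓡 4) ∞ (capGlue u) ∧ Injective (capGlue u) ∧
      ∀ y, Injective (mfderiv (𝓡 2) (𝓡 4) (capGlue u) y) := by
  refine ⟨contMDiff_twoChartGlue (contMDiff_val_comp hu.contMDiff) (hu.contMDiff_pencilCap hε hJstd)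
      (pencilCap_compat u),
    injective_twoChartGlue (Subtype.val_injective.comp hu.injective) (pencilCap_zero_notMem_range u),
    injective_mfderiv_twoChartGlue (contMDiff_val_comp hu.contMDiff) (hu.contMDiff_pencilCap hε hJstd)
      (pencilCap_compat u) (fun ξ => ?_) (hu.injective_mfderiv_pencilCap hε hJstd)⟩
  rw [(hasMFDerivAt_val_comp (hu.mdifferentiableAt ξ)).mfderiv]
  exact hu.injective_mfderiv ξ

/-- Values of the capped sphere on the `ℂ`-chart. [folklore] -/
theorem capGlue_of_coordNeZero_zero {q : ComplexProjectiveSpace 1} (hq : CoordNeZero 0 q) :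
    capGlue u q = (u (affineCoordComplex 0 q 0)).1 :=
  twoChartGlue_of_coordNeZero_zero hq

/-- Values of the capped sphere on the chart at infinity. [folklore] -/
theorem capGlue_of_coordNeZero_one {q : ComplexProjectiveSpace 1} (hq : CoordNeZero 1 q) :
    capGlue u q = pencilCap p u (affineCoordComplex 1 q 0) :=
  twoChartGlue_of_coordNeZero_one (pencilCap_compat u) hq

end Cap

/-! ### The compactified member in the blown-up end `Y` -/

namespace PencilEnd

variable {M : Type} [TopologicalSpace M] [T2Space M] [ChartedSpace (EuclideanSpace ℝ (Fin 4)) M]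
  [IsManifold (𝓡 4) ∞ M] {p : M} (G : PencilEnd p)
  {J : ∀ x : punctured p, TangentSpace (𝓡 4) x →L[ℝ] TangentSpace (𝓡 4) x}
  {u : ℂ → punctured p} {b : ℂ}

/-- **The compactified member in `Y`** as a map `ℂℙ¹ → Y`: the glued map of `G.memberU u` and
`G.memberV u b`. [cite: Wendl2018, proof of Prop. 2.53 (p. 65)] -/
def memberGlue (u : ℂ → punctured p) (b : ℂ) : ComplexProjectiveSpace 1 → G.Y :=
  twoChartGlue (G.memberU u) (G.memberV u b)

/-- The two charts of the compactified member are compatible. [folklore] -/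
theorem memberV_compat (u : ℂ → punctured p) (b : ℂ) (z : ℂ) (hz : z ≠ 0) :
    G.memberV u b z = G.memberU u z⁻¹ :=
  G.memberV_eq_memberU_inv hz

/-- Values of the compactified member on the `ℂ`-chart. [folklore] -/
theorem memberGlue_of_coordNeZero_zero {q : ComplexProjectiveSpace 1} (hq : CoordNeZero 0 q) :
    G.memberGlue u b q = G.inP (u (affineCoordComplex 0 q 0)) :=
  twoChartGlue_of_coordNeZero_zero hq

/-- Values of the compactified member on the chart at infinity. [folklore] -/
theorem memberGlue_of_coordNeZero_one {q : ComplexProjectiveSpace 1} (hq : CoordNeZero 1 q) :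
    G.memberGlue u b q = G.memberV u b (affineCoordComplex 1 q 0) :=
  twoChartGlue_of_coordNeZero_one (G.memberV_compat u b) hq

/-- **The compactified member lies over the capped sphere**: on the `ℂ`-chart it is `inP` of the
capped sphere. [folklore] -/
theorem memberGlue_eq_inP_of_coordNeZero_zero {q : ComplexProjectiveSpace 1} (hq : CoordNeZero 0 q) :
    G.memberGlue u b q = G.inP (u (affineCoordComplex 0 q 0)) ∧
      capGlue u q = (u (affineCoordComplex 0 q 0)).1 :=
  ⟨G.memberGlue_of_coordNeZero_zero hq, capGlue_of_coordNeZero_zero hq⟩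

/-- At the point at infinity the compactified member is the exceptional point `inBox (0, b)` and the
capped sphere is `p`. [folklore] -/
theorem memberGlue_of_not_coordNeZero_zero {q : ComplexProjectiveSpace 1} (hq : ¬ CoordNeZero 0 q) :
    G.memberGlue u b q = G.inBox ((0 : ℂ), b) ∧ capGlue u q = p := by
  have h1 := coordNeZero_one_of_not_coordNeZero_zero hq
  rw [G.memberGlue_of_coordNeZero_one h1, capGlue_of_coordNeZero_one h1,
    affineCoordComplex_one_eq_zero hq, memberV_zero, pencilCap_zero]
  exact ⟨rfl, rfl⟩

/-- **The compactified member is a `C^∞` injective immersion `ℂℙ¹ → Y`.**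
[cite: Wendl2018, proof of Prop. 2.53 (p. 65)] -/
theorem memberGlue_smooth_injective_immersion [CompactSpace M] (hu : IsPencilPlane J u b)
    (hb : ‖b - G.b₀‖ < G.ρ')
    (hJstd : ∀ x : punctured p, InPuncturedChartBall p G.rad x →
      ∀ (v : TangentSpace (𝓡 4) x) (c : EuclideanSpace ℝ (Fin 4)),
        inner ℝ (fderiv ℝ inversion (extChartAt (𝓡 4) p x.1 - extChartAt (𝓡 4) p p)
          (mfderiv (𝓡 4) 𝓘(ℝ, EuclideanSpace ℝ (Fin 4))
            (fun z : punctured p => extChartAt (𝓡 4) p z.1) x (J x v))) c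
        = stdSymplecticForm (fderiv ℝ inversion (extChartAt (𝓡 4) p x.1 - extChartAt (𝓡 4) p p)
          (mfderiv (𝓡 4) 𝓘(ℝ, EuclideanSpace ℝ (Fin 4))
            (fun z : punctured p => extChartAt (𝓡 4) p z.1) x v)) c) :
    ContMDiff (𝓡 2) (𝓡 4) ∞ (G.memberGlue u b) ∧ Injective (G.memberGlue u b) ∧
      ∀ y, Injective (mfderiv (𝓡 2) (𝓡 4) (G.memberGlue u b) y) :=
  ⟨contMDiff_twoChartGlue (G.contMDiff_memberU hu.contMDiff) (G.contMDiff_memberV hu hb hJstd)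
      (G.memberV_compat u b),
    injective_twoChartGlue (G.injective_memberU hu.injective) (G.memberV_zero_notMem_range hb),
    injective_mfderiv_twoChartGlue (G.contMDiff_memberU hu.contMDiff) (G.contMDiff_memberV hu hb hJstd)
      (G.memberV_compat u b) (G.injective_mfderiv_memberU hu) (G.injective_mfderiv_memberV hu hb hJstd)⟩

/-- The image of the compactified member: `inP (u(ℂ)) ∪ {inBox (0, b)}`. [folklore] -/
theorem range_memberGlue :
    range (G.memberGlue u b) = range (G.memberU u) ∪ {G.memberV u b 0} := by
  apply Subset.antisymm
  · rintro _ ⟨q, rfl⟩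
    by_cases h0 : CoordNeZero 0 q
    · exact Or.inl ⟨_, (G.memberGlue_of_coordNeZero_zero h0).symm⟩
    · rw [(G.memberGlue_of_not_coordNeZero_zero h0).1, memberV_zero]
      exact Or.inr rfl
  · rintro y (⟨ξ, rfl⟩ | hy)
    · refine ⟨(affineChart 0).symm (realCoordinates 1 (fun _ : Fin 1 => ξ)), ?_⟩
      rw [G.memberGlue_of_coordNeZero_zero (coordNeZero_affineChart_symm 0 _),
        affineCoordComplex_affineChart_symm]
      rfl
    · rw [mem_singleton_iff] at hy
      refine ⟨(affineChart 1).symm (realCoordinates 1 (fun _ : Fin 1 => (0 : ℂ))), ?_⟩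
      rw [hy, (G.memberGlue_of_not_coordNeZero_zero not_coordNeZero_zero_affineChart_one_symm).1,
        memberV_zero]

end PencilEnd

end Literature.Geometry.Symplectic
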